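import Summits.Parity.GeneralizedHardyLittlewood.Theorems.FordMaynardSieveConst01651SieveConst01651LinePart03
import Summits.Parity.GeneralizedHardyLittlewood.Theorems.FordMaynardSieveConst01651SieveConst01651KernelForm
import Summits.Parity.GeneralizedHardyLittlewood.Theorems.FordMaynardSieveConst01651GCert01651R
import Summits.Parity.GeneralizedHardyLittlewood.Theorems.FordMaynardSieveConst01651SieveConst01651MainCaseH
import HarnessLib

/-!
# Route `FordMaynardSieveConst01651`, target `SieveConst01651` (stmt-Parity-19185): line `sieve_decomposition` re-homed — proofs, part 4 of 11 (file 5 of 12)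

File 5 of 12 of the VERBATIM re-homing under `Theorems/` of the registered line skeleton
`Summits/Parity/GeneralizedHardyLittlewood/Cruxes/SieveConst01651/Lines/sieve_decomposition.lean` (v21, sha16
`ada6d0765119a11e`; author seat `linewriter-parity-smallroutes-1`, g0 v1–v20 / g1 v21): Ford–Maynard, Theorem 7.3 (a) at
`P = (1/2, 0, ν)` with CLOSED support, cut along arXiv:2407.14368 §7.2 / §6.2, composed down to the route target
`Summit.Parity.GeneralizedHardyLittlewood.Theses.FordMaynardSieveConst01651.SieveConst01651`.  Namespace
`Summit.Parity.GeneralizedHardyLittlewood.FordMaynardSieveConst01651SieveDecomposition` (fresh; the `Cruxes` copy keeps its own), files of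
≤ 400 lines chained by import; the three registered stubs are replaced by their landed proofs
(`…StubSignClauseFive` p834287, `…StubCertValuePos` p837763, `…TypeIIRegion` p833045), so the skeleton's composition
`SieveConst01651_of_stubs` (last part) is sorry-free.  Mathematics, statements and comments are the linewriter's; this
re-homing (hand `leafhand-parity-fordmaynardsieveco-2` g4) only moved the definitions (`Eset`, `sliceTest`, `mainG1`, `vk`,
the `Signature.*` statement abbreviations, `Phi`, `innerI`, `jumpSet`, `gval`, `symmExt`, `idxProd`, `gam`) into the first
file, added docstrings where missing, and renamed two unused binders.
Declarations in this part: `weight_jumps`, `typeI_term`, `sieve_lower`, `symmExt_perm`, `isSymmetric_symmExt`, `symmExt_of_monotone`, `starSum_symmExt_of_monotone`, `sieveBoundG1_symmExt`, `isPiecewiseConstOnCone_symmExt`, `supportClosed_symmExt`, `starSum_nonpos_of_cone`, `card_windowPrimes_eq`.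

References: [FordMaynard2024PrimeSieves] K. Ford, J. Maynard, *On the theory of prime producing sieves*, arXiv:2407.14368,
Theorem 7.3 (a), Proposition 7.19, §6.2, §7.2, §8.2.
-/

noncomputable section

open Finset
open Literature.NumberTheory.Sieve Literature.NumberTheory.Sieve.FordMaynard Literature.Barriers.Parity.FordMaynard
open Summit.Parity.GeneralizedHardyLittlewood.FordMaynardSieveConst01651SieveConst01651
  (hfun Admissible hfun_apply hfun_of_ne pvec roughPart smoothPart Gwt Hwt window IsRough Nset Rset mem_window mem_Nset mem_Rset
   coneCert openSmall stub_hkPieces stub_coneCertClosed_of_residues' coneCert_signClause_five_of_generic)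

namespace Summit.Parity.GeneralizedHardyLittlewood.FordMaynardSieveConst01651SieveDecomposition

/-- `weight_jumps` — lemma of the line skeleton `sieve_decomposition` (v21, seat `linewriter-parity-smallroutes-1`), re-homed verbatim. [folklore] -/
theorem weight_jumps : Signature.weightJumps := by
  intro ν hν hν4 g hadm
  have hadm' := hadm
  obtain ⟨-, hpc, hg0, hsupp, -⟩ := hadm
  choose Mnum P c hP hg using hpc
  set K₀ : ℕ := ⌊1 / ν⌋₊ with hK₀
  set Mmax : ℕ := ∑ K ∈ range (K₀ + 1), Mnum K with hMmax
  refine ⟨2 + 2 * (Mmax : ℝ), fun m hm N => ?_⟩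
  classical
  have hm0 : m ≠ 0 := by omega
  have hτ1 : 1 ≤ m.divisors.card := Finset.card_pos.2 ⟨m, Nat.mem_divisors_self m hm0⟩
  rcases eq_or_lt_of_le hm with hm1 | hm2
  · subst hm1
    have h0 : ((Ico 1 N).filter (fun k : ℕ => Gwt g ν (1 * (k + 1)) 1 ≠ Gwt g ν (1 * k) 1)).card = 0 := by
      rw [Finset.card_eq_zero, Finset.filter_eq_empty_iff]
      intro k hk
      rw [mem_Ico] at hk
      rw [not_not, Gwt_one hadm' (by omega), Gwt_one hadm' (by omega)]
    rw [h0]; push_cast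
    have : (0 : ℝ) ≤ Mmax := Nat.cast_nonneg _
    have : (1 : ℝ) ≤ (Nat.divisors 1).card := by exact_mod_cast hτ1
    nlinarith
  set b : ℕ → Bool := fun k => decide ((m : ℝ) ≤ ((m * k : ℕ) : ℝ) ^ (1 / 2 : ℝ)) with hb
  set d₂ : ℕ → ℕ := fun k => roughPart (((m * k : ℕ) : ℝ) ^ ν) m with hd₂
  set χ : (e : ℕ) → Fin (Mnum e.primeFactorsList.length) → ℕ → Bool :=
    fun e j k => decide (pvec (m * k) e ∈ P _ j) with hχ
  have hd₂pos : ∀ k, d₂ k ≠ 0 := fun k h0 =>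
    hm0 (Nat.eq_zero_of_zero_dvd (h0 ▸ roughPart_dvd' _ (Nat.pos_of_ne_zero hm0)))
  have hgK : ∀ (K : ℕ) (x : Fin K → ℝ), g K x ≠ 0 → K ≤ K₀ := by
    intro K x h
    rcases hsupp K x h with h1 | ⟨h2, h3⟩
    · rw [h1]; exact Nat.zero_le _
    · by_contra hk
      have hkpos : 0 < K := by omega
      have hlt : (K : ℝ) * ν < 1 / 2 := by
        calc (K : ℝ) * ν = ∑ _i : Fin K, ν := by simp
          _ < ∑ i, x i := by
              apply Finset.sum_lt_sum_of_nonempty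
              · exact Finset.univ_nonempty_iff.2 ⟨⟨0, hkpos⟩⟩
              · intro i _; exact h2 i
          _ ≤ 1 / 2 := h3
      apply hk
      apply Nat.le_floor
      rw [le_div_iff₀ hν]
      linarith
  have hG : ∀ k', Gwt g ν (m * k') m = if (m : ℝ) ≤ ((m * k' : ℕ) : ℝ) ^ (1 / 2 : ℝ) then
      ((ArithmeticFunction.moebius (m / d₂ k') : ℤ) : ℝ) * gval g (m * k') (d₂ k') else 0 :=
    fun k' => Gwt_eq_gval g ν (m * k') m
  have hincl : jumpSet (fun k => Gwt g ν (m * k) m) N ⊆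
      (jumpSet b N ∪ jumpSet d₂ N) ∪
        (m.divisors.filter (fun e => e.primeFactorsList.length ≤ K₀)).biUnion
          (fun e => (univ : Finset (Fin (Mnum e.primeFactorsList.length))).biUnion
            (fun j => jumpSet (χ e j) N)) := by
    intro k hk
    rw [mem_jumpSet] at hk
    obtain ⟨⟨hk1, hkN⟩, hne⟩ := hk
    rw [mem_union, mem_union]
    by_cases hbk : b (k + 1) = b k
    swap
    · exact Or.inl (Or.inl (mem_jumpSet.2 ⟨⟨hk1, hkN⟩, hbk⟩))
    by_cases hdk : d₂ (k + 1) = d₂ k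
    swap
    · exact Or.inl (Or.inr (mem_jumpSet.2 ⟨⟨hk1, hkN⟩, hdk⟩))
    right
    have hPQ : ((m : ℝ) ≤ ((m * (k + 1) : ℕ) : ℝ) ^ (1 / 2 : ℝ)) ↔ ((m : ℝ) ≤ ((m * k : ℕ) : ℝ) ^ (1 / 2 : ℝ)) := by
      simpa [hb] using hbk
    rw [hG, hG, hdk] at hne
    by_cases hQ : (m : ℝ) ≤ ((m * k : ℕ) : ℝ) ^ (1 / 2 : ℝ)
    swap
    · rw [if_neg hQ, if_neg (fun h => hQ (hPQ.1 h))] at hne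
      exact absurd rfl hne
    rw [if_pos hQ, if_pos (hPQ.2 hQ)] at hne
    have hgne : gval g (m * (k + 1)) (d₂ k) ≠ gval g (m * k) (d₂ k) := fun h => hne (by rw [h])
    have hediv : d₂ k ∈ m.divisors := Nat.mem_divisors.2 ⟨roughPart_dvd' _ (Nat.pos_of_ne_zero hm0), hm0⟩
    have hK : (d₂ k).primeFactorsList.length ≤ K₀ := by
      by_cases h1 : gval g (m * k) (d₂ k) = 0
      · have h2 : gval g (m * (k + 1)) (d₂ k) ≠ 0 := by rw [h1] at hgne; exact hgne
        exact hgK _ _ h2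
      · exact hgK _ _ h1
    rw [mem_biUnion]
    refine ⟨d₂ k, mem_filter.2 ⟨hediv, hK⟩, ?_⟩
    rw [mem_biUnion]
    have hex : ∀ n, gval g n (d₂ k) = ∑ j, if pvec n (d₂ k) ∈ P _ j then c _ j else 0 := fun n =>
      hg _ (pvec n (d₂ k)) (_root_.Summit.Parity.GeneralizedHardyLittlewood.FordMaynardSieveConst01651SieveConst01651.pvec_mono n (d₂ k))
    rw [hex, hex] at hgne
    by_contra hall
    apply hgne
    refine sum_congr rfl fun j _ => ?_
    have hj' : χ (d₂ k) j (k + 1) = χ (d₂ k) j k := by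
      by_contra h
      exact hall ⟨j, mem_univ j, mem_jumpSet.2 ⟨⟨hk1, hkN⟩, h⟩⟩
    have hiff : pvec (m * (k + 1)) (d₂ k) ∈ P _ j ↔ pvec (m * k) (d₂ k) ∈ P _ j := by
      simpa [hχ] using hj'
    by_cases hp : pvec (m * k) (d₂ k) ∈ P _ j
    · rw [if_pos hp, if_pos (hiff.2 hp)]
    · rw [if_neg hp, if_neg (fun h => hp (hiff.1 h))]
  have hb1 : (jumpSet b N).card ≤ 1 := by
    apply card_jumpSet_le_one_of_monotone
    intro k hk h
    simp only [hb, decide_eq_true_eq] at h ⊢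
    refine h.trans ?_
    apply Real.rpow_le_rpow (Nat.cast_nonneg _) _ (by norm_num)
    exact_mod_cast Nat.mul_le_mul_left m (Nat.le_succ k)
  have hd1 : (jumpSet d₂ N).card ≤ m.divisors.card := by
    apply card_jumpSet_le_of_antitone
    · intro k hk
      have hdvd : d₂ (k + 1) ∣ d₂ k := by
        simp only [hd₂]
        apply roughPart_dvd_of_le
        apply Real.rpow_le_rpow (Nat.cast_nonneg _) _ hν.le
        exact_mod_cast Nat.mul_le_mul_left m (Nat.le_succ k)
      exact Nat.le_of_dvd (Nat.pos_of_ne_zero (hd₂pos k)) hdvd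
    · intro k hk
      exact Nat.mem_divisors.2 ⟨roughPart_dvd' _ (Nat.pos_of_ne_zero hm0), hm0⟩
  have hχ2 : ∀ e ∈ m.divisors, ∀ j : Fin (Mnum e.primeFactorsList.length),
      (jumpSet (χ e j) N).card ≤ 2 := by
    intro e he j
    apply card_jumpSet_le_two_of_ordConvex
    intro k₁ k₂ k₃ hk₁ h12 h23 hS₁ hS₃
    simp only [hχ, decide_eq_true_eq] at hS₁ hS₃ ⊢
    have hn1 : 1 < m * k₁ := by nlinarith
    exact pvec_mem_between (hP _ j).1 hn1 (Nat.mul_le_mul_left m h12) (Nat.mul_le_mul_left m h23) hS₁ hS₃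
  have hMle : ∀ e ∈ m.divisors.filter (fun e => e.primeFactorsList.length ≤ K₀),
      ((univ : Finset (Fin (Mnum e.primeFactorsList.length))).biUnion (fun j => jumpSet (χ e j) N)).card
        ≤ 2 * Mmax := by
    intro e he
    rw [mem_filter] at he
    calc _ ≤ ∑ j : Fin (Mnum e.primeFactorsList.length), (jumpSet (χ e j) N).card := card_biUnion_le
      _ ≤ ∑ _j : Fin (Mnum e.primeFactorsList.length), 2 := sum_le_sum fun j _ => hχ2 e he.1 j
      _ = 2 * Mnum e.primeFactorsList.length := by simp [mul_comm]
      _ ≤ 2 * Mmax := by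
          apply Nat.mul_le_mul_left
          exact single_le_sum (f := Mnum) (fun K _ => Nat.zero_le _)
            (mem_range.2 (Nat.lt_succ_of_le he.2))
  have hcardN : (jumpSet (fun k => Gwt g ν (m * k) m) N).card
      ≤ 1 + m.divisors.card + m.divisors.card * (2 * Mmax) := by
    calc _ ≤ ((jumpSet b N ∪ jumpSet d₂ N) ∪
          (m.divisors.filter (fun e => e.primeFactorsList.length ≤ K₀)).biUnion
            (fun e => (univ : Finset (Fin (Mnum e.primeFactorsList.length))).biUnion
              (fun j => jumpSet (χ e j) N))).card := card_le_card hincl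
      _ ≤ (jumpSet b N ∪ jumpSet d₂ N).card +
          ((m.divisors.filter (fun e => e.primeFactorsList.length ≤ K₀)).biUnion
            (fun e => (univ : Finset (Fin (Mnum e.primeFactorsList.length))).biUnion
              (fun j => jumpSet (χ e j) N))).card := card_union_le _ _
      _ ≤ ((jumpSet b N).card + (jumpSet d₂ N).card) +
          ∑ e ∈ m.divisors.filter (fun e => e.primeFactorsList.length ≤ K₀),
            ((univ : Finset (Fin (Mnum e.primeFactorsList.length))).biUnion
              (fun j => jumpSet (χ e j) N)).card := add_le_add (card_union_le _ _) card_biUnion_le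
      _ ≤ (1 + m.divisors.card) +
          ∑ _e ∈ m.divisors.filter (fun e => e.primeFactorsList.length ≤ K₀), 2 * Mmax :=
          add_le_add (add_le_add hb1 hd1) (sum_le_sum hMle)
      _ ≤ 1 + m.divisors.card + m.divisors.card * (2 * Mmax) := by
          rw [sum_const, smul_eq_mul]
          apply Nat.add_le_add_left
          exact Nat.mul_le_mul_right _ (card_filter_le _ _)
  have hreal : ((jumpSet (fun k => Gwt g ν (m * k) m) N).card : ℝ)
      ≤ 1 + m.divisors.card + m.divisors.card * (2 * Mmax) := by exact_mod_cast hcardN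
  have hτ : (1 : ℝ) ≤ m.divisors.card := by exact_mod_cast hτ1
  have hM0 : (0 : ℝ) ≤ Mmax := Nat.cast_nonneg _
  calc (((Ico 1 N).filter (fun k : ℕ => Gwt g ν (m * (k + 1)) m ≠ Gwt g ν (m * k) m)).card : ℝ)
      = ((jumpSet (fun k => Gwt g ν (m * k) m) N).card : ℝ) := by rfl
    _ ≤ 1 + m.divisors.card + m.divisors.card * (2 * Mmax) := hreal
    _ ≤ (2 + 2 * (Mmax : ℝ)) * (m.divisors.card : ℝ) := by nlinarith

/-- `typeI_term` — lemma of the line skeleton `sieve_decomposition` (v21, seat `linewriter-parity-smallroutes-1`), re-homed verbatim. [folklore] -/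
theorem typeI_term : Signature.typeITerm := typeITerm_of_jumps weight_jumps

/-- `sieve_lower` — lemma of the line skeleton `sieve_decomposition` (v21, seat `linewriter-parity-smallroutes-1`), re-homed verbatim. [folklore] -/
theorem sieve_lower {ν x M : ℝ} {g : VecFn} {a : ℕ → ℝ}
    (hP : ∀ p : ℕ, p.Prime → Hwt g ν p = 1)
    (hN : ∀ n : ℕ, 2 ≤ n → ¬ n.Prime → IsRough ν n → ¬ IsExc n → Hwt g ν n ≤ 0)
    (hM : ∀ n : ℕ, 2 ≤ n → IsRough ν n → |Hwt g ν n| ≤ M)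
    (ha : ∀ n, 0 ≤ a n) :
    ((windowPrimes x).card : ℝ) + ∑ n ∈ Nset ν x, Hwt g ν n
      - |∑ n ∈ window x, (a n - 1) * Hwt g ν n| - |∑ n ∈ Rset ν x, (a n - 1) * Hwt g ν n|
      - M * ∑ n ∈ Eset ν x, a n ≤ ∑ p ∈ windowPrimes x, a p := by
  classical
  set H := Hwt g ν with hH
  set f : ℕ → ℝ := fun n => (a n - 1) * H n with hf
  have hsplit1 := (sum_filter_add_sum_filter_not (window x) Nat.Prime f)
  rw [filter_prime_window] at hsplit1
  have hNeq : ((window x).filter (fun n => ¬ n.Prime)).filter (fun n => 2 ≤ n ∧ IsRough ν n) = Nset ν x := by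
    ext n; rw [mem_filter, mem_filter, mem_Nset]; tauto
  have hReq : ((window x).filter (fun n => ¬ n.Prime)).filter (fun n => ¬ (2 ≤ n ∧ IsRough ν n)) = Rset ν x := by
    ext n; rw [mem_filter, mem_filter, mem_Rset]; tauto
  have hsplit2 := (sum_filter_add_sum_filter_not ((window x).filter (fun n => ¬ n.Prime))
    (fun n => 2 ≤ n ∧ IsRough ν n) f)
  rw [hNeq, hReq] at hsplit2
  have hprime : ∑ p ∈ windowPrimes x, f p = ∑ p ∈ windowPrimes x, a p - ((windowPrimes x).card : ℝ) := by
    have : ∀ p ∈ windowPrimes x, f p = a p - 1 := by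
      intro p hp
      rw [mem_windowPrimes] at hp
      simp [hf, hP p hp.1]
    rw [sum_congr rfl this, sum_sub_distrib, sum_const, nsmul_eq_mul, mul_one]
  have hNsum : ∑ n ∈ Nset ν x, f n = ∑ n ∈ Nset ν x, a n * H n - ∑ n ∈ Nset ν x, H n := by
    rw [← sum_sub_distrib]
    exact sum_congr rfl fun n _ => by simp [hf]; ring
  have hEeq : (Nset ν x).filter IsExc = Eset ν x := by
    ext n; rw [mem_filter, mem_Eset]
  have hNa : ∑ n ∈ Nset ν x, a n * H n ≤ M * ∑ n ∈ Eset ν x, a n := by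
    rw [← sum_filter_add_sum_filter_not (Nset ν x) IsExc, hEeq, mul_sum]
    have h1 : ∑ n ∈ Eset ν x, a n * H n ≤ ∑ n ∈ Eset ν x, M * a n := by
      refine sum_le_sum fun n hn => ?_
      obtain ⟨hnN, -⟩ := mem_Eset.1 hn
      obtain ⟨-, h2, -, hr⟩ := mem_Nset.1 hnN
      have := hM n h2 hr
      rw [mul_comm M]
      exact mul_le_mul_of_nonneg_left (le_of_abs_le this) (ha n)
    have h2 : ∑ n ∈ (Nset ν x).filter (fun n => ¬ IsExc n), a n * H n ≤ 0 := by
      refine sum_nonpos fun n hn => ?_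
      rw [mem_filter, mem_Nset] at hn
      obtain ⟨⟨-, h2, hp, hr⟩, he⟩ := hn
      exact mul_nonpos_of_nonneg_of_nonpos (ha n) (hN n h2 hp hr he)
    linarith
  have habsW := neg_abs_le (∑ n ∈ window x, f n)
  have habsR := le_abs_self (∑ n ∈ Rset ν x, f n)
  linarith

/-- `symmExt_perm` — lemma of the line skeleton `sieve_decomposition` (v21, seat `linewriter-parity-smallroutes-1`), re-homed verbatim. [folklore] -/
theorem symmExt_perm (g₀ : VecFn) (k : ℕ) (σ : Equiv.Perm (Fin k)) (x : Fin k → ℝ) :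
    symmExt g₀ k (x ∘ σ) = symmExt g₀ k x := by
  simp only [symmExt]
  rw [Tuple.comp_perm_comp_sort_eq_comp_sort]

/-- `isSymmetric_symmExt` — lemma of the line skeleton `sieve_decomposition` (v21, seat `linewriter-parity-smallroutes-1`), re-homed verbatim. [folklore] -/
theorem isSymmetric_symmExt (g₀ : VecFn) : (symmExt g₀).IsSymmetric :=
  fun k σ x => symmExt_perm g₀ k σ x

/-- `symmExt_of_monotone` — lemma of the line skeleton `sieve_decomposition` (v21, seat `linewriter-parity-smallroutes-1`), re-homed verbatim. [folklore] -/
theorem symmExt_of_monotone (g₀ : VecFn) {k : ℕ} {x : Fin k → ℝ} (hx : Monotone x) :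
    symmExt g₀ k x = g₀ k x := by
  simp only [symmExt]
  rw [Tuple.sort_eq_refl_iff_monotone.mpr hx]
  simp

/-- `starSum_symmExt_of_monotone` — lemma of the line skeleton `sieve_decomposition` (v21, seat `linewriter-parity-smallroutes-1`), re-homed verbatim. [folklore] -/
theorem starSum_symmExt_of_monotone (g₀ : VecFn) {k : ℕ} {x : Fin k → ℝ} (hx : Monotone x) :
    starSum (symmExt g₀) k x = starSum g₀ k x := by
  unfold starSum
  refine Finset.sum_congr rfl fun A _ => ?_
  exact symmExt_of_monotone g₀ (hx.comp (A.orderEmbOfFin rfl).monotone)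

/-- `sieveBoundG1_symmExt` — lemma of the line skeleton `sieve_decomposition` (v21, seat `linewriter-parity-smallroutes-1`), re-homed verbatim. [folklore] -/
theorem sieveBoundG1_symmExt (ν : ℝ) (g₀ : VecFn) :
    sieveBoundG1 ν (symmExt g₀) = sieveBoundG1 ν g₀ := by
  unfold sieveBoundG1
  congr 1
  refine Finset.sum_congr rfl fun k _ => ?_
  congr 1
  funext x
  split_ifs with h
  · rw [starSum_symmExt_of_monotone g₀ h.2]
  · rfl

/-- `isPiecewiseConstOnCone_symmExt` — lemma of the line skeleton `sieve_decomposition` (v21, seat `linewriter-parity-smallroutes-1`), re-homed verbatim. [folklore] -/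
theorem isPiecewiseConstOnCone_symmExt {g₀ : VecFn} (h : IsPiecewiseConstOnCone g₀) :
    IsPiecewiseConstOnCone (symmExt g₀) := by
  intro k
  obtain ⟨m, P, c, hP, hg⟩ := h k
  exact ⟨m, P, c, hP, fun x hx => by rw [symmExt_of_monotone g₀ hx]; exact hg x hx⟩

/-- `supportClosed_symmExt` — lemma of the line skeleton `sieve_decomposition` (v21, seat `linewriter-parity-smallroutes-1`), re-homed verbatim. [folklore] -/
theorem supportClosed_symmExt {ν : ℝ} {g₀ : VecFn}
    (h : ∀ (k : ℕ) (x : Fin k → ℝ), Monotone x → g₀ k x ≠ 0 →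
      k = 0 ∨ ((∀ i, ν < x i) ∧ ∑ i, x i ≤ 1 / 2)) :
    ∀ (k : ℕ) (x : Fin k → ℝ), symmExt g₀ k x ≠ 0 →
      k = 0 ∨ ((∀ i, ν < x i) ∧ ∑ i, x i ≤ 1 / 2) := by
  intro k x hne
  have hmono : Monotone (x ∘ ⇑(Tuple.sort x)) := Tuple.monotone_sort x
  rcases h k _ hmono hne with h0 | ⟨hall, hsum⟩
  · exact Or.inl h0
  · refine Or.inr ⟨fun i => ?_, ?_⟩
    · simpa using hall ((Tuple.sort x).symm i)
    · have : (∑ i, (x ∘ ⇑(Tuple.sort x)) i) = ∑ i, x i := by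
        simp only [Function.comp_apply]
        exact Equiv.sum_comp (Tuple.sort x) x
      rwa [this] at hsum

/-- `starSum_nonpos_of_cone` — lemma of the line skeleton `sieve_decomposition` (v21, seat `linewriter-parity-smallroutes-1`), re-homed verbatim. [folklore] -/
theorem starSum_nonpos_of_cone {g₀ : VecFn}
    (hH : ∀ k : ℕ, 2 ≤ k → k ≤ 6 → ∀ x : Fin k → ℝ, Monotone x →
      (∀ i, (1651 / 10000 : ℝ) < x i ∧ x i < 1 - 1651 / 10000) → ∑ i, x i = 1 →
        starSum g₀ k x ≤ 0) :
    ∀ k : ℕ, 2 ≤ k → ∀ x : Fin k → ℝ,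
      (∀ i, (1651 / 10000 : ℝ) < x i ∧ x i < 1 - 1651 / 10000) → ∑ i, x i = 1 →
        starSum (symmExt g₀) k x ≤ 0 := by
  intro k hk x hbox hsum
  have hk6 : k ≤ 6 := _root_.Summit.Parity.GeneralizedHardyLittlewood.FordMaynardSieveConst01651GCert01651R.dim_le_six (fun i => (hbox i).1) hsum
  rw [← _root_.Summit.Parity.GeneralizedHardyLittlewood.FordMaynardSieveConst01651SieveConst01651.starSum_perm' (isSymmetric_symmExt g₀) k (Tuple.sort x) x,
    starSum_symmExt_of_monotone g₀ (Tuple.monotone_sort x)]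
  refine hH k hk hk6 _ (Tuple.monotone_sort x) (fun i => hbox _) ?_
  have : (∑ i, (x ∘ ⇑(Tuple.sort x)) i) = ∑ i, x i := by
    simp only [Function.comp_apply]
    exact Equiv.sum_comp (Tuple.sort x) x
  rw [this, hsum]

/-- `card_windowPrimes_eq` — lemma of the line skeleton `sieve_decomposition` (v21, seat `linewriter-parity-smallroutes-1`), re-homed verbatim. [folklore] -/
theorem card_windowPrimes_eq {x : ℝ} (hx : 0 ≤ x) :
    ((windowPrimes x).card : ℝ) = (Nat.primeCounting ⌊x⌋₊ : ℝ) - (Nat.primeCounting ⌊x / 2⌋₊ : ℝ) := by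
  have hsplit := card_filter_add_card_filter_not (s := Nat.primesLE ⌊x⌋₊)
    (fun p : ℕ => x / 2 < (p : ℝ))
  have hneg : (Nat.primesLE ⌊x⌋₊).filter (fun p : ℕ => ¬ (x / 2 < (p : ℝ))) = Nat.primesLE ⌊x / 2⌋₊ := by
    ext p
    simp only [mem_filter, Nat.mem_primesLE, not_lt]
    constructor
    · rintro ⟨⟨-, hp⟩, hle⟩
      exact ⟨Nat.le_floor hle, hp⟩
    · rintro ⟨hle, hp⟩
      have h2 : (p : ℝ) ≤ x / 2 := (Nat.cast_le.2 hle).trans (Nat.floor_le (by positivity))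
      exact ⟨⟨Nat.le_floor (h2.trans (by linarith)), hp⟩, h2⟩
  rw [hneg, Nat.primesLE_card_eq_primeCounting, Nat.primesLE_card_eq_primeCounting] at hsplit
  have : ((windowPrimes x).card : ℝ) + (Nat.primeCounting ⌊x / 2⌋₊ : ℝ) = (Nat.primeCounting ⌊x⌋₊ : ℝ) := by
    rw [windowPrimes]; exact_mod_cast hsplit
  linarith

end Summit.Parity.GeneralizedHardyLittlewood.FordMaynardSieveConst01651SieveDecomposition

end
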